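import Summits.HodgeConjecture.CorCM.Census.HalfParityFloor
import Summits.HodgeConjecture.CorCM.Census.HalfParityBlocks

/-!
# The half-parity law, VIII: THE LIFT THEOREM — `H`-invariant ambient functionals that are `G`-invariant on the faces are exactly
# «parity combination + one admissible half-parity»

COR-CM (cell `pub-hodgecm2`), count-neutral kernel combinatorics by the binder seat b09 (gen 30; lane HALF-PARITY-LAW), part VIII,
sequel of parts I–III and VII.  Two bookkeeping definitions (`liftHalf`, `liftCoeff`) + theorems; no `Prop`-valued definition, no
`decide` beyond identities in `𝔽₂` with ≤ 2 variables, no certificate, no named fact, no `sorry`.  HONEST FRAMING: `HC_CM` is NOT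
proved; nothing here is a period or a headline.

THE QUESTION.  Parts I–VII attach to every index-two subgroup `H ∋ c` the admissible half-parities `hsum A` and the invariant
`t(G, c)`; André-3's law says that together with the block parities they span ALL `G`-invariant functionals of the coinvariant
fibre `(Λ ⊗ 𝔽₂)_G`.  Which functionals are these, intrinsically?  ANSWER (this file): a functional `w` of the AMBIENT permutation
module `𝔽₂[types]` which is (i) invariant under the index-two subgroup `H ∋ c` and (ii) `G`-invariant on the faces mod `2` is
EXACTLY a block-parity combination plus ONE admissible half-parity of `H` (`exists_eq_sum_par2_add_hsum`, converse
`sum_par2_add_hsum_invariant`).  So `parities + half-parities = the functionals of the fibre that LIFT to an H-invariant ambient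
functional for some index-two H ∋ c`, and the law becomes the lifting statement «every `G`-invariant functional on `(Λ ⊗ 𝔽₂)_G`
is a sum of `H`-liftable ones» — equivalently its obstruction class in `H¹(G, Λ̄^⊥)` dies on restriction to index-two subgroups
containing `c` (not formalised; the classes themselves are part I's `χ_H ∪ 1_R`).

CONTENT.
* §1 `H`-invariant ambient functionals along an index-two `H`: values on a block are two numbers `u = w[Φ]`, `v = w[Φ·g⁻¹]`
  (`g ∉ H` fixed), read through `apply_single_rt_of_mem` / `apply_single_rt_of_notMem`.
* §2 THE EXPLICIT LIFT DATA: `liftHalf w g = {Ψ | w[Ψ] = 1, w[Ψ·g⁻¹] = 0}` (a half-block set of `H`: `liftHalf_stable`,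
  `liftHalf_disjoint`) and `liftCoeff w g b = w[out b]·w[(out b)·g⁻¹]`; the pointwise identity `w[Ψ] = liftCoeff (blk Ψ) + [Ψ ∈ liftHalf]`
  (`apply_single_eq`) and its linear extension **`w = Σ_b liftCoeff_b · par2_b + hsum liftHalf`** on ALL of `𝔽₂[types]` (`apply_eq`).
* §3 ADMISSIBILITY from `G`-invariance on the faces (`liftHalf_mem_admHalves`): the relation `hsum (sat liftHalf)` is the coboundary
  `w∘g − w`, which kills `face2`.  MAIN `exists_eq_sum_par2_add_hsum`; converse `sum_par2_add_hsum_invariant`.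
* §4 `t` REFORMULATED (`apply_eq_zero_of_hpi_eq_zero`, `hpi_eq_zero_of_forall_lift`): on `hodge2 ∩ ker par2`, the joint kernel of all
  admissible half-parities is the joint kernel of all liftable functionals (all `H`) — `t(G, c)` is the rank of the LIFTABLE invariant
  functionals modulo parities.

## References
* [Pohlmann1968] H. Pohlmann, Algebraic cycles on abelian varieties of complex multiplication type, Ann. of Math. 88 (1968), Thm 1.
* [Milne1999] J. S. Milne, Lefschetz motives and the Tate conjecture, Compositio Math. 117 (1999), Prop. 2.1, p. 54.
-/

namespace Summit.HodgeConjecture.CorCM.Census.HalfParity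

open Finset
open Summit.HodgeConjecture.CorCM.Prior.AllgGroup.RfwfAllgGroup
open Summit.HodgeConjecture.CorCM.Census.BlockParity
open Summit.HodgeConjecture.CorCM.Census.Coinvariant

noncomputable section

variable {G : Type*} [Group G] [Fintype G] [DecidableEq G] (c : G)

/-! ## §1 Values of an `H`-invariant ambient functional along a block -/

section Lift

variable {H : Subgroup G} (hH : H.index = 2) {w : (CMF G c →₀ ZMod 2) →ₗ[ZMod 2] ZMod 2}
  (hw : ∀ Q ∈ H, ∀ x : CMF G c →₀ ZMod 2, w (Finsupp.mapDomain (rt c Q) x) = w x) {g : G} (hg : g ∉ H)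
include hw

/-- `w[Ψ·Q⁻¹] = w[Ψ]` for `Q ∈ H`. [folklore] -/
theorem apply_single_rt_of_mem {Q : G} (hQ : Q ∈ H) (Ψ : CMF G c) :
    w (Finsupp.single (rt c Q Ψ) 1) = w (Finsupp.single Ψ 1) := by
  rw [← Finsupp.mapDomain_single (f := rt c Q), hw Q hQ]

include hH in
/-- `w[Ψ·Q⁻¹] = w[Ψ·g⁻¹]` for `Q ∉ H` (`Q ∈ Hg`). [folklore] -/
theorem apply_single_rt_of_notMem (hg : g ∉ H) {Q : G} (hQ : Q ∉ H) (Ψ : CMF G c) :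
    w (Finsupp.single (rt c Q Ψ) 1) = w (Finsupp.single (rt c g Ψ) 1) := by
  have hQg : Q * g⁻¹ ∈ H := by
    rw [Subgroup.mul_mem_iff_of_index_two hH, H.inv_mem_iff]
    exact ⟨fun h => absurd h hQ, fun h => absurd h hg⟩
  have e : rt c Q Ψ = rt c (Q * g⁻¹) (rt c g Ψ) := by rw [← rt_mul, inv_mul_cancel_right]
  rw [e, apply_single_rt_of_mem c hw hQg]

include hH in
/-- `w[(Ψ·g⁻¹)·Q⁻¹] = w[Ψ]` for `Q ∉ H` (`Qg ∈ H`). [folklore] -/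
theorem apply_single_rt_rt_of_notMem (hg : g ∉ H) {Q : G} (hQ : Q ∉ H) (Ψ : CMF G c) :
    w (Finsupp.single (rt c Q (rt c g Ψ)) 1) = w (Finsupp.single Ψ 1) := by
  have hQg : Q * g ∈ H := by
    rw [Subgroup.mul_mem_iff_of_index_two hH]
    exact ⟨fun h => absurd h hQ, fun h => absurd h hg⟩
  rw [← rt_mul, apply_single_rt_of_mem c hw hQg]

/-! ## §2 The explicit lift data -/

omit hw in
/-- **The half-block set read off `w`**: `liftHalf w g = {Ψ | w[Ψ] = 1 and w[Ψ·g⁻¹] = 0}`. [folklore] -/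
def liftHalf (w : (CMF G c →₀ ZMod 2) →ₗ[ZMod 2] ZMod 2) (g : G) : Finset (CMF G c) := by
  classical
  exact (univ : Finset (CMF G c)).filter fun Ψ => w (Finsupp.single Ψ 1) = 1 ∧ w (Finsupp.single (rt c g Ψ) 1) = 0

omit hw in
/-- Membership in `liftHalf`. [folklore] -/
theorem mem_liftHalf (w : (CMF G c →₀ ZMod 2) →ₗ[ZMod 2] ZMod 2) (g : G) (Ψ : CMF G c) :
    Ψ ∈ liftHalf c w g ↔ w (Finsupp.single Ψ 1) = 1 ∧ w (Finsupp.single (rt c g Ψ) 1) = 0 := by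
  classical
  unfold liftHalf
  rw [mem_filter]
  simp only [mem_univ, true_and]

omit hw in
/-- **The parity coefficients read off `w`**: `liftCoeff w g b = w[out b] · w[(out b)·g⁻¹]`. [folklore] -/
def liftCoeff (w : (CMF G c →₀ ZMod 2) →ₗ[ZMod 2] ZMod 2) (g : G) (b : Block c) : ZMod 2 :=
  w (Finsupp.single (Quotient.out b) 1) * w (Finsupp.single (rt c g (Quotient.out b)) 1)

include hH in
/-- **`liftHalf` is `H`-stable.** [folklore] -/
theorem liftHalf_stable (hg : g ∉ H) : ∀ Q ∈ H, ∀ Ψ ∈ liftHalf c w g, rt c Q Ψ ∈ liftHalf c w g := by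
  intro Q hQ Ψ hΨ
  obtain ⟨h1, h0⟩ := (mem_liftHalf c w g Ψ).mp hΨ
  refine (mem_liftHalf c w g _).mpr ⟨by rw [apply_single_rt_of_mem c hw hQ, h1], ?_⟩
  have hgQ : g * Q ∉ H := fun h => hg (by rwa [Subgroup.mul_mem_cancel_right H hQ] at h)
  rw [← rt_mul, apply_single_rt_of_notMem c hH hw hg hgQ, h0]

include hH in
/-- **`liftHalf` is disjoint from its outside translates.** [folklore] -/
theorem liftHalf_disjoint (hg : g ∉ H) : ∀ Q ∉ H, ∀ Ψ ∈ liftHalf c w g, rt c Q Ψ ∉ liftHalf c w g := by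
  intro Q hQ Ψ hΨ hQΨ
  obtain ⟨-, h0⟩ := (mem_liftHalf c w g Ψ).mp hΨ
  obtain ⟨h1, -⟩ := (mem_liftHalf c w g _).mp hQΨ
  rw [apply_single_rt_of_notMem c hH hw hg hQ, h0] at h1
  exact zero_ne_one h1

include hH in
/-- **The pointwise identity**: `w[Ψ] = liftCoeff (blk Ψ) + [Ψ ∈ liftHalf]`. [folklore] -/
theorem apply_single_eq (hg : g ∉ H) (Ψ : CMF G c) :
    w (Finsupp.single Ψ 1) = liftCoeff c w g (blk c Ψ) + if Ψ ∈ liftHalf c w g then 1 else 0 := by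
  classical
  have key : ∀ u v : ZMod 2, u = u * v + if u = 1 ∧ v = 0 then 1 else 0 := by decide
  have key' : ∀ u v : ZMod 2, v = u * v + if v = 1 ∧ u = 0 then 1 else 0 := by decide
  have hb : blk c (Quotient.out (blk c Ψ)) = blk c Ψ := Quotient.out_eq _
  obtain ⟨Q, hQ⟩ := exists_rt_eq_of_blk_eq c hb
  simp only [mem_liftHalf, liftCoeff]
  by_cases hQH : Q ∈ H
  · have hgQ : g * Q ∉ H := fun h => hg (by rwa [Subgroup.mul_mem_cancel_right H hQH] at h)
    have e1 := apply_single_rt_of_mem c hw hQH (Quotient.out (blk c Ψ))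
    have e2 := apply_single_rt_of_notMem c hH hw hg hgQ (Quotient.out (blk c Ψ))
    rw [rt_mul, hQ] at e2
    rw [hQ] at e1
    rw [e1, e2]
    exact key _ _
  · have hgQ : g * Q ∈ H := by
      rw [Subgroup.mul_mem_iff_of_index_two hH]
      exact ⟨fun h => absurd h hg, fun h => absurd h hQH⟩
    have e1 := apply_single_rt_of_notMem c hH hw hg hQH (Quotient.out (blk c Ψ))
    have e2 := apply_single_rt_of_mem c hw hgQ (Quotient.out (blk c Ψ))
    rw [rt_mul, hQ] at e2
    rw [hQ] at e1
    rw [e1, e2]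
    exact key' _ _

include hH in
/-- **THE LIFT IDENTITY on all of `𝔽₂[types]`: `w = Σ_b liftCoeff_b · par2_b + hsum liftHalf`.** [folklore] -/
theorem apply_eq (hg : g ∉ H) (x : CMF G c →₀ ZMod 2) :
    w x = ∑ b, liftCoeff c w g b * par2 c x b + hsum c (liftHalf c w g) x := by
  induction x using Finsupp.induction_linear with
  | zero => simp
  | add f f' hf hf' =>
    rw [map_add, hf, hf', map_add]
    simp only [map_add, Pi.add_apply, mul_add, Finset.sum_add_distrib]
    abel
  | single Ψ r =>
    have e : Finsupp.single Ψ r = r • Finsupp.single Ψ 1 := by rw [Finsupp.smul_single, smul_eq_mul, mul_one]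
    rw [sum_mul_par2_single, hsum_single, e, map_smul, smul_eq_mul, apply_single_eq c hH hw hg Ψ, mul_add]
    congr 1
    split_ifs <;> simp

/-! ## §3 Admissibility and the main theorem -/

include hH in
/-- The relation of `liftHalf` is the coboundary of `w`: `hsum (sat liftHalf) x = w (x·g⁻¹) + w x`. [folklore] -/
theorem hsum_sat_liftHalf (hg : g ∉ H) (x : CMF G c →₀ ZMod 2) :
    hsum c (sat c (liftHalf c w g)) x = w (Finsupp.mapDomain (rt c g) x) + w x := by
  have hcob := hsum_mapDomain_rt_of_notMem c hH (liftHalf_stable c hH hw hg) (liftHalf_disjoint c hH hw hg) hg x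
  have e1 := apply_eq c hH hw hg x
  have e2 := apply_eq c hH hw hg (Finsupp.mapDomain (rt c g) x)
  rw [sum_par2_mapDomain_rt] at e2
  have key : ∀ p s s' w₁ w₂ : ZMod 2, w₁ = p + s → w₂ = p + s' → s' = s + (w₂ + w₁) := by decide
  have h := key _ _ _ _ _ e1 e2
  rw [h] at hcob
  have key2 : ∀ s r q : ZMod 2, s + q = s + r → r = q := by decide
  exact key2 _ _ _ hcob

include hH in
/-- **Admissibility**: if `w` is moreover `G`-invariant on the faces mod `2` (and `c ∈ H`), `liftHalf w g` is an admissible half-block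
set. [folklore] -/
theorem liftHalf_mem_admHalves (hc2 : c * c = 1) (hcH : c ∈ H) (hg : g ∉ H)
    (hwG : ∀ (Q : G), ∀ x ∈ face2 c hc2, w (Finsupp.mapDomain (rt c Q) x) = w x) :
    liftHalf c w g ∈ admHalves c hc2 := by
  refine mem_admHalves_of c hc2 hH hcH (liftHalf_stable c hH hw hg) (liftHalf_disjoint c hH hw hg) fun x hx => ?_
  rw [LinearMap.mem_ker, hsum_sat_liftHalf c hH hw hg, hwG g x hx]
  have key : ∀ u : ZMod 2, u + u = 0 := by decide
  exact key _

include hH in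
/-- **THE LIFT THEOREM.**  An ambient functional `w` invariant under an index-two subgroup `H ∋ c` and `G`-invariant on the faces
mod `2` is a block-parity combination plus ONE admissible half-parity: `w = Σ_b a_b · par2_b + hsum A`, `A ∈ admHalves`. [folklore] -/
theorem exists_eq_sum_par2_add_hsum (hc2 : c * c = 1) (hcH : c ∈ H)
    (hwG : ∀ (Q : G), ∀ x ∈ face2 c hc2, w (Finsupp.mapDomain (rt c Q) x) = w x) :
    ∃ a : Block c → ZMod 2, ∃ A ∈ admHalves c hc2, ∀ x, w x = ∑ b, a b * par2 c x b + hsum c A x := by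
  obtain ⟨g, hg, -⟩ := Subgroup.index_eq_two_iff_exists_notMem_and.mp hH
  exact ⟨liftCoeff c w g, liftHalf c w g, liftHalf_mem_admHalves c hH hw hc2 hcH hg hwG, apply_eq c hH hw hg⟩

end Lift

/-- **Converse**: a block-parity combination plus an admissible half-parity (via `H`) IS an `H`-invariant ambient functional which is
`G`-invariant on the whole Hodge lattice mod `2`. [folklore] -/
theorem sum_par2_add_hsum_invariant {hc2 : c * c = 1} {H : Subgroup G} (hH : H.index = 2) (a : Block c → ZMod 2)
    {A : Finset (CMF G c)} (hst : ∀ Q ∈ H, ∀ Ψ ∈ A, rt c Q Ψ ∈ A) (hdj : ∀ Q ∉ H, ∀ Ψ ∈ A, rt c Q Ψ ∉ A)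
    (hrel : face2 c hc2 ≤ LinearMap.ker (hsum c (sat c A))) :
    (∀ Q ∈ H, ∀ x : CMF G c →₀ ZMod 2,
        ∑ b, a b * par2 c (Finsupp.mapDomain (rt c Q) x) b + hsum c A (Finsupp.mapDomain (rt c Q) x) =
          ∑ b, a b * par2 c x b + hsum c A x) ∧
      ∀ (Q : G), ∀ x ∈ hodge2 c hc2,
        ∑ b, a b * par2 c (Finsupp.mapDomain (rt c Q) x) b + hsum c A (Finsupp.mapDomain (rt c Q) x) =
          ∑ b, a b * par2 c x b + hsum c A x :=
  ⟨fun Q hQ x => by rw [sum_par2_mapDomain_rt, hsum_mapDomain_rt_of_mem c hst hQ],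
    fun Q x hx => by rw [sum_par2_mapDomain_rt, hsum_mapDomain_rt_of_mem_hodge2 c hH hst hdj hrel Q hx]⟩

/-! ## §4 `t` reformulated: liftable functionals -/

/-- A liftable functional kills every `x ∈ ker par2 ∩ ker hpi`. [folklore] -/
theorem apply_eq_zero_of_hpi_eq_zero (hc2 : c * c = 1) {H : Subgroup G} (hH : H.index = 2) (hcH : c ∈ H)
    {w : (CMF G c →₀ ZMod 2) →ₗ[ZMod 2] ZMod 2} (hw : ∀ Q ∈ H, ∀ x : CMF G c →₀ ZMod 2, w (Finsupp.mapDomain (rt c Q) x) = w x)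
    (hwG : ∀ (Q : G), ∀ x ∈ face2 c hc2, w (Finsupp.mapDomain (rt c Q) x) = w x) {x : CMF G c →₀ ZMod 2} (hpx : par2 c x = 0)
    (hx : hpi c hc2 x = 0) : w x = 0 := by
  obtain ⟨a, A, hA, hwx⟩ := exists_eq_sum_par2_add_hsum c hH hw hc2 hcH hwG
  rw [hwx x, hpx]
  have h := congrFun hx ⟨A, hA⟩
  rw [hpi_apply] at h
  simp [h]

/-- Conversely, `x ∈ ker par2` killed by every liftable functional (for every index-two `H ∋ c`) lies in `ker hpi`: **on the parity
kernel, the admissible half-parities and the liftable invariant functionals have the same joint kernel** — `t(G, c)` is the rank of the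
liftable functionals modulo parities. [folklore] -/
theorem hpi_eq_zero_of_forall_lift (hc2 : c * c = 1) {x : CMF G c →₀ ZMod 2}
    (h : ∀ (H : Subgroup G), H.index = 2 → c ∈ H → ∀ w : (CMF G c →₀ ZMod 2) →ₗ[ZMod 2] ZMod 2,
      (∀ Q ∈ H, ∀ y : CMF G c →₀ ZMod 2, w (Finsupp.mapDomain (rt c Q) y) = w y) →
      (∀ (Q : G), ∀ y ∈ face2 c hc2, w (Finsupp.mapDomain (rt c Q) y) = w y) → w x = 0) :
    hpi c hc2 x = 0 := by
  funext A
  obtain ⟨H, hH, hcH, hst, hdj, hrel⟩ := (mem_admHalves c hc2 A.1).mp A.2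
  rw [hpi_apply, Pi.zero_apply]
  refine h H hH hcH (hsum c A.1) (fun Q hQ y => hsum_mapDomain_rt_of_mem c hst hQ y) fun Q y hy => ?_
  exact hsum_mapDomain_rt_of_mem_hodge2 c hH hst hdj hrel Q (Submodule.mem_sup_left hy)

end

end Summit.HodgeConjecture.CorCM.Census.HalfParity
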